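import Summits.CriticalPhenomena.PercolationContinuityZ3.Theorems.Transplant.KNParaChainSchedNP
import Summits.CriticalPhenomena.PercolationContinuityZ3.Theorems.Transplant.KNCells2ChainAppend
import HarnessLib

/-!
# N2 (frames-only node `SamePDropOfSkeletonFrm₁`, OPEN), LEVEL 1, (C) column: APPENDING two schedules with parking `ChainPlanar.ScheduleNP` —
# `S₁.appendNP S₂` (radii AND zone radii agree, first core of `S₂` = last core of `S₁`); the twin of `ScheduleN.appendN` (KNParaChainAppendN, p5-g8)
# with the route DICHOTOMY carried piecewise — the glue for the K-G corridor's same-frame segment [E-run (`RunPrm.scheduleN….toNP`)] ⧺ [a-parking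
# (`ParkPrm.scheduleNP`)] (B9-CORRIDOR-BOX.md §A3); cross-frame segments are joined by the two-window chain as in N1.  Pure `Site 2`.

builds on p205010 (kernel theorem, internal audit signed; external expert review pending) — nothing in this file uses p205010; nothing here is a
claim about the open node `SamePDropOfSkeletonFrm₁`.
Lane `prim-bschramm`, seat `prim-bschramm-p5` (gen 15; (C) lineage); helper file (`--supports stmt-CriticalPhenomena-4575`).
* **`ScheduleNP.appendNP S₁ S₂ (hR : S₂.R' = S₁.R') (hρ : S₂.ρ = S₁.ρ) (hjoin : S₂.core 0 = S₁.core (S₁.N + 1))`**; `appendNP_params`; **`appendNP_left`**,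
  **`appendNP_right`**, `appendNP_core_left'`, `appendNP_core_zero`, `appendNP_core_last`, `appendNP_region_subset`.
[cite: KozmaNitzan2024, §4 Lemma 12 (pp. 23–25)] [cite: MartineauTassion2017, §4.3 Lemma 4.2]
-/

noncomputable section

namespace Summit.CriticalPhenomena.PercolationContinuityZ3.Theorems

namespace Transplant

namespace ChainPlanar

open Literature.Probability.Percolation Literature.Probability.LatticeModels
open Literature.Probability.Percolation.KozmaNitzan
open Literature.Probability.Percolation.KozmaNitzan.Cells (oth oth_ne eq_oth_of_ne)

namespace ScheduleNP

/-- **Appending two parking schedules**: run `S₁` (steps `0, …, N₁`), then `S₂` (its step `j` becomes step `N₁ + 1 + j`), provided the radii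
agree and the first core of `S₂` is the last core of `S₁`; stride data and regions piecewise, prism the union.
[cite: KozmaNitzan2024, §4 Lemma 12 (pp. 23–25)] -/
def appendNP (S₁ S₂ : ScheduleNP) (hR : S₂.R' = S₁.R') (hρ : S₂.ρ = S₁.ρ) (hjoin : S₂.core 0 = S₁.core (S₁.N + 1)) : ScheduleNP where
  ax := pw S₁.N S₁.ax S₂.ax
  lo := pw S₁.N S₁.lo S₂.lo
  hi := pw S₁.N S₁.hi S₂.hi
  region := pw S₁.N S₁.region S₂.region
  prism := S₁.prism ∪ S₂.prism
  N := S₁.N + 1 + S₂.N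
  R' := S₁.R'
  ρ := S₁.ρ
  sLo := pw S₁.N S₁.sLo S₂.sLo
  sHi := pw S₁.N S₁.sHi S₂.sHi
  d := pw S₁.N S₁.d S₂.d
  Pp := pw S₁.N S₁.Pp S₂.Pp
  Pm := pw S₁.N S₁.Pm S₂.Pm
  La := pw S₁.N S₁.La S₂.La
  Lb := pw S₁.N S₁.Lb S₂.Lb
  encl k hk := by
    by_cases h : k ≤ S₁.N
    · simp only [pw_of_le _ _ h]
      exact S₁.encl k h
    · obtain ⟨j, rfl⟩ : ∃ j, k = S₁.N + 1 + j := ⟨k - (S₁.N + 1), by omega⟩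
      simp only [pw_add, ← hR]
      exact S₂.encl j (by omega)
  succ k hk := by
    by_cases h : k + 1 ≤ S₁.N
    · simp only [pw_of_le _ _ h, pw_of_le _ _ (Nat.le_of_succ_le h)]
      exact S₁.succ k (Nat.le_of_succ_le h)
    · by_cases h' : k = S₁.N
      · subst h'
        rw [pw_of_le _ _ le_rfl, pw_of_not_le _ _ (by omega), pw_of_not_le _ _ (by omega), Nat.sub_self]
        have e : Finset.Icc (S₂.lo 0) (S₂.hi 0) = S₂.core 0 := rfl
        rw [e, hjoin]
        exact S₁.succ S₁.N le_rfl
      · obtain ⟨j, rfl⟩ : ∃ j, k = S₁.N + 1 + j := ⟨k - (S₁.N + 1), by omega⟩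
        simp only [pw_add, pw_add_succ]
        exact S₂.succ j (by omega)
  sub_prism k hk := by
    by_cases h : k ≤ S₁.N
    · simp only [pw_of_le _ _ h]
      exact (S₁.sub_prism k h).trans Finset.subset_union_left
    · obtain ⟨j, rfl⟩ : ∃ j, k = S₁.N + 1 + j := ⟨k - (S₁.N + 1), by omega⟩
      simp only [pw_add]
      exact (S₂.sub_prism j (by omega)).trans Finset.subset_union_right
  nonempty k hk := by
    by_cases h : k ≤ S₁.N
    · simp only [pw_of_le _ _ h]
      exact S₁.nonempty k (by omega)
    · obtain ⟨j, rfl⟩ : ∃ j, k = S₁.N + 1 + j := ⟨k - (S₁.N + 1), by omega⟩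
      simp only [pw_add]
      exact S₂.nonempty j (by omega)
  routeP k hk v hv := by
    by_cases h : k ≤ S₁.N
    · simp only [pw_of_le _ _ h] at hv ⊢
      obtain ⟨σ, hσ, hlink, hrest⟩ := S₁.routeP k h v hv
      refine ⟨σ, hσ, hlink, ?_⟩
      -- the next core of the appended schedule at step k
      have hnext : Finset.Icc (pw S₁.N S₁.lo S₂.lo (k + 1)) (pw S₁.N S₁.hi S₂.hi (k + 1)) = Finset.Icc (S₁.lo (k + 1)) (S₁.hi (k + 1)) := by
        by_cases h' : k + 1 ≤ S₁.N
        · simp only [pw_of_le _ _ h']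
        · have ek : k = S₁.N := by omega
          subst ek
          rw [pw_of_not_le _ _ (by omega), pw_of_not_le _ _ (by omega), Nat.sub_self]
          have e : Finset.Icc (S₂.lo 0) (S₂.hi 0) = S₂.core 0 := rfl
          rw [e, hjoin]; rfl
      rw [hnext]
      exact hrest
    · obtain ⟨j, rfl⟩ : ∃ j, k = S₁.N + 1 + j := ⟨k - (S₁.N + 1), by omega⟩
      simp only [pw_add, pw_add_succ, ← hR, ← hρ] at hv ⊢
      exact S₂.routeP j (by omega) v hv

variable (S₁ S₂ : ScheduleNP) (hR : S₂.R' = S₁.R') (hρ : S₂.ρ = S₁.ρ) (hjoin : S₂.core 0 = S₁.core (S₁.N + 1))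

/-- The parameters of the appended parking schedule: `N = N₁ + 1 + N₂`, `R' = R'₁`, prism the union. [folklore] -/
theorem appendNP_params : (S₁.appendNP S₂ hR hρ hjoin).N = S₁.N + 1 + S₂.N ∧ (S₁.appendNP S₂ hR hρ hjoin).R' = S₁.R' ∧
    (S₁.appendNP S₂ hR hρ hjoin).ρ = S₁.ρ ∧ (S₁.appendNP S₂ hR hρ hjoin).prism = S₁.prism ∪ S₂.prism :=
  ⟨rfl, rfl, rfl, rfl⟩

/-- **The first steps (`k ≤ N₁`) of the appended schedule are the steps of `S₁`**: axis, region, levels, core and the seven stride fields. [folklore] -/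
theorem appendNP_left {k : ℕ} (hk : k ≤ S₁.N) :
    (S₁.appendNP S₂ hR hρ hjoin).ax k = S₁.ax k ∧ (S₁.appendNP S₂ hR hρ hjoin).region k = S₁.region k ∧
    (∀ i, (S₁.appendNP S₂ hR hρ hjoin).level k i = S₁.level k i) ∧ (S₁.appendNP S₂ hR hρ hjoin).core k = S₁.core k ∧
    (S₁.appendNP S₂ hR hρ hjoin).sLo k = S₁.sLo k ∧ (S₁.appendNP S₂ hR hρ hjoin).sHi k = S₁.sHi k ∧ (S₁.appendNP S₂ hR hρ hjoin).d k = S₁.d k ∧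
    (S₁.appendNP S₂ hR hρ hjoin).Pp k = S₁.Pp k ∧ (S₁.appendNP S₂ hR hρ hjoin).Pm k = S₁.Pm k ∧ (S₁.appendNP S₂ hR hρ hjoin).La k = S₁.La k ∧
    (S₁.appendNP S₂ hR hρ hjoin).Lb k = S₁.Lb k := by
  refine ⟨pw_of_le _ _ hk, pw_of_le _ _ hk, fun i => ?_, ?_, pw_of_le _ _ hk, pw_of_le _ _ hk, pw_of_le _ _ hk, pw_of_le _ _ hk,
    pw_of_le _ _ hk, pw_of_le _ _ hk, pw_of_le _ _ hk⟩
  · show Finset.Icc (pw S₁.N S₁.lo S₂.lo k - ((i : ℕ) : Site 2)) (pw S₁.N S₁.hi S₂.hi k + ((i : ℕ) : Site 2)) = _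
    rw [pw_of_le _ _ hk, pw_of_le _ _ hk]; rfl
  · show Finset.Icc (pw S₁.N S₁.lo S₂.lo k) (pw S₁.N S₁.hi S₂.hi k) = _
    rw [pw_of_le _ _ hk, pw_of_le _ _ hk]; rfl

/-- **The later steps (`N₁ + 1 + j`) of the appended schedule are the steps of `S₂` at `j`**: axis, region, levels, core and the seven stride fields.
[folklore] -/
theorem appendNP_right (j : ℕ) :
    (S₁.appendNP S₂ hR hρ hjoin).ax (S₁.N + 1 + j) = S₂.ax j ∧ (S₁.appendNP S₂ hR hρ hjoin).region (S₁.N + 1 + j) = S₂.region j ∧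
    (∀ i, (S₁.appendNP S₂ hR hρ hjoin).level (S₁.N + 1 + j) i = S₂.level j i) ∧ (S₁.appendNP S₂ hR hρ hjoin).core (S₁.N + 1 + j) = S₂.core j ∧
    (S₁.appendNP S₂ hR hρ hjoin).sLo (S₁.N + 1 + j) = S₂.sLo j ∧ (S₁.appendNP S₂ hR hρ hjoin).sHi (S₁.N + 1 + j) = S₂.sHi j ∧
    (S₁.appendNP S₂ hR hρ hjoin).d (S₁.N + 1 + j) = S₂.d j ∧ (S₁.appendNP S₂ hR hρ hjoin).Pp (S₁.N + 1 + j) = S₂.Pp j ∧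
    (S₁.appendNP S₂ hR hρ hjoin).Pm (S₁.N + 1 + j) = S₂.Pm j ∧ (S₁.appendNP S₂ hR hρ hjoin).La (S₁.N + 1 + j) = S₂.La j ∧
    (S₁.appendNP S₂ hR hρ hjoin).Lb (S₁.N + 1 + j) = S₂.Lb j := by
  refine ⟨pw_add _ _ _ _, pw_add _ _ _ _, fun i => ?_, ?_, pw_add _ _ _ _, pw_add _ _ _ _, pw_add _ _ _ _, pw_add _ _ _ _, pw_add _ _ _ _,
    pw_add _ _ _ _, pw_add _ _ _ _⟩
  · show Finset.Icc (pw S₁.N S₁.lo S₂.lo (S₁.N + 1 + j) - ((i : ℕ) : Site 2)) (pw S₁.N S₁.hi S₂.hi (S₁.N + 1 + j) + ((i : ℕ) : Site 2)) = _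
    rw [pw_add, pw_add]; rfl
  · show Finset.Icc (pw S₁.N S₁.lo S₂.lo (S₁.N + 1 + j)) (pw S₁.N S₁.hi S₂.hi (S₁.N + 1 + j)) = _
    rw [pw_add, pw_add]; rfl

/-- The cores up to the joint (`k ≤ N₁ + 1`) of the appended parking schedule are the cores of `S₁`. [folklore] -/
theorem appendNP_core_left' {k : ℕ} (hk : k ≤ S₁.N + 1) : (S₁.appendNP S₂ hR hρ hjoin).core k = S₁.core k := by
  rcases Nat.lt_or_eq_of_le hk with h | rfl
  · exact (appendNP_left S₁ S₂ hR hρ hjoin (Nat.lt_succ_iff.1 h)).2.2.2.1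
  · rw [show S₁.N + 1 = S₁.N + 1 + 0 by omega, (appendNP_right S₁ S₂ hR hρ hjoin 0).2.2.2.1, hjoin]

/-- The first core of the appended parking schedule is the first core of `S₁`. [folklore] -/
theorem appendNP_core_zero : (S₁.appendNP S₂ hR hρ hjoin).core 0 = S₁.core 0 := (appendNP_left S₁ S₂ hR hρ hjoin (Nat.zero_le _)).2.2.2.1

/-- **The last core of the appended parking schedule is the last core of `S₂`.** [folklore] -/
theorem appendNP_core_last : (S₁.appendNP S₂ hR hρ hjoin).core ((S₁.appendNP S₂ hR hρ hjoin).N + 1) = S₂.core (S₂.N + 1) := by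
  rw [(appendNP_params S₁ S₂ hR hρ hjoin).1, show S₁.N + 1 + S₂.N + 1 = S₁.N + 1 + (S₂.N + 1) by omega,
    (appendNP_right S₁ S₂ hR hρ hjoin (S₂.N + 1)).2.2.2.1]

/-- Every region of the appended parking schedule lies in `S₁.prism ∪ S₂.prism`. [folklore] -/
theorem appendNP_region_subset {k : ℕ} (hk : k ≤ (S₁.appendNP S₂ hR hρ hjoin).N) : (S₁.appendNP S₂ hR hρ hjoin).region k ⊆ S₁.prism ∪ S₂.prism :=
  (S₁.appendNP S₂ hR hρ hjoin).sub_prism k hk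

end ScheduleNP

end ChainPlanar

end Transplant

end Summit.CriticalPhenomena.PercolationContinuityZ3.Theorems

end
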